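/-
Copyright (c) 2026 the pub-hodgecm-mathlib formalisation cell (harness21).  Prover seat hodgecm-mathlib-K2E1-p15 (g0), Track B ∕ K2-LIT «5Res (b) BL-2(χ,τ)», h413 =
`stmt-HodgeConjecture-24833`, line `K2_E1_TraceFormulaBeta`, route of record `HCCMUnconditional`; order of record = TABLE 13th issue §F (dealer K2E1-plan (g6) close
2026-09-04T11:25Z) «K2E1-p15 row 13 `K2E1ChiEisensteinMeromorphicU2` (global NF glue over balls … for `E(f_z^φ)`)»; REPORT-FIRST `K2/STATUS.md` 11:20Z.
-/
import Summits.HodgeConjecture.HodgeConjecture.Theorems.K2E1SphericalEisensteinMeromorphicOfBallsU2   -- ★ p858943 (K2E3-p12): the spherical print twinned here; brings ★ G-a `exists_meromorphicOn_univ_of_balls`, ★ RegularU holomorphy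
import Summits.HodgeConjecture.HodgeConjecture.Theorems.K2E1BLMeromorphicFamilyByproductsU           -- ★ (K2E1-p08): `exists_global_pole_set_of_lt` (NF gluing with ONE common pole set)
import HarnessLib

/-!
# K2·E1 — `K2E1ChiEisensteinMeromorphicU2`: THE WHOLE-PLANE MEROMORPHIC CONTINUATION OF THE `χ`-EISENSTEIN SERIES `E(f_z^φ)` OF `U(1,1)_{L∕L⁺}` FROM PER-BALL PIECES, AND THE
# COMMON POLE SET OF THE GLUED FAMILY — the `(χ, τ)` print of ★ `K2E1SphericalEisensteinMeromorphicOfBallsU2` ∕ ★ `exists_global_pole_set_of_lt` [arXiv:1911.02342, §2.1 + §4 p. 10]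

Track B ∕ K2-LIT, crux h413 = `stmt-HodgeConjecture-24833`; cell `hodgecm-mathlib`, squad K2, ENGINE E1, campaign «5Res», road of record «BL-2(χ,τ) ∘ MS-2(χ,τ) ∘
ARCH-UNITARITY ∘ R8₂» (SHEET `K2/K2-defs1/g6/SHEET-5Res-b-chi-twins.K2-defs1-g6.md` row 13; TABLE 13th issue §F).  THEOREMS ONLY (no `def`, no `instance`, no notation, no
named-fact hypothesis, no `sorry`); lane `--kind proof --supports stmt-HodgeConjecture-24833 --as helper` (count-neutral).  Closes no socket.

WHAT CHANGES WITH `(χ, τ)` — NOTHING IN THE GLUE.  The spherical gluing ★ `sphericalEisenstein_meromorphic_of_balls` is hypothesis-first on the per-ball scalar pieces and sees the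
section only through the holomorphy of `z ↦ E(φH^z)(g)` on the Godement half-plane `{Re z > 1}`, which is ★ `differentiableOn_eisensteinSeriesU_flatSectionU_cm_two` for EVERY
bounded `φ` — in particular for every `χ`-section `φ ∈ V(χ, τ, U)` (★ p859551 `chiSectionSpace`; bounded and continuous).  So §1 is the print `fun _ => φ₀ ↦ φ`: from per-ball pieces
(row 12b `K2E1ChiEisensteinMeromorphicBallU2`, K2E1-p10 — taken here as the BINDER `hball` in ★ X1's shape) to ONE `Ec : ℂ → (G(𝔸) → ℂ)`, meromorphic on all of `ℂ` in `z` for every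
`g`, `= E(f_z^φ)` for `Re z > 1`.  §2 is the pole-set edition: ★ `exists_global_pole_set_of_lt` (normal-form gluing of per-ball pieces of NON-NEGATIVE ORDER on the per-ball holomorphy
sets `U n`, `n ≥ n₀`, into functions analytic off ONE closed co-discrete `P ⊆ {Re ≤ 1}`) instantiated at `σ₀ = 1` and the index `ι := G(𝔸) ⊕ J`: the Eisenstein family `g ↦ E(f_z^φ)(g)`
TOGETHER WITH an arbitrary family `j ↦ q_j` of scalar coefficient pieces holomorphic on `{Re > 1}` (the entries of the continued intertwining OPERATOR `M(z, χ) ∈ Hom(V, V′)` in bases —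
the `(χ,τ)` replacement of ★ X2's single coefficient `c̃`, index `Option G(𝔸)`; or `J` empty) share ONE pole set — the (E1) half of the `(χ,τ)`-EXPORTS X2_χ (K2E1-p14).

* §1 **`chiEisenstein_meromorphic_of_balls`**, `…_of_eventually_balls` — whole plane from the balls, bounded `φ`.
* §2 **`chiEisenstein_meromorphic_globalPoleSet_of_balls`** — ONE common pole set `P` for the glued Eisenstein family and the coefficient pieces; (E1) analytic off `P`; Godement
  agreement; NF-germ agreement with the ball pieces; `P ⊆ {Re ≤ 1}` closed co-discrete; off `P` either `1 < Re z` or `z` lies in two consecutive holomorphy sets.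

HONEST LABEL: HC_CM is proved only modulo the 7 printed citations (2 remaining named inputs: hLiu418 = `stmt-HodgeConjecture-24832`, h413 = `stmt-HodgeConjecture-24833`) until rung 0
closes; this file asserts no named fact, is conditional by construction on the per-ball letters (`hball` ∕ `hF…`, row 12b's output), and closes no socket.  NOT claimed: location of
the poles inside `{Re ≤ 1}` (MS-2(χ,τ) ★ `K2E1ChiMaassSelbergContinuedCMTwo` + (d)), the constant term of `Ec` off the Godement domain, the functional equation.

## References
* [BernsteinLapid2019] J. Bernstein, E. Lapid, *On the meromorphic continuation of Eisenstein series*, arXiv:1911.02342 (J. AMS 37 (2024), doi:10.1090/jams/1020), Thm 2.3, §2.1, §4 p. 10.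
* [MoeglinWaldspurger1995] C. Mœglin, J.-L. Waldspurger, *Spectral decomposition and Eisenstein series* (1995), II.1.5 (convergence), IV.1.8–IV.1.10 (continuation).
* [Iwaniec2002] H. Iwaniec, *Spectral Methods of Automorphic Forms* (2nd ed., 2002), §6.2.
-/

set_option autoImplicit false
set_option linter.dupNamespace false  -- the mandated namespace repeats the summit's segment (`HodgeConjecture.HodgeConjecture`)

noncomputable section

open Set Filter Topology NumberField
open Literature.NumberTheory.Automorphic Literature.NumberTheory.Automorphic.UnitaryGroup
open Summit.HodgeConjecture.HodgeConjecture.Cruxes.H413.K2E1BorelEisensteinU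
open Summit.HodgeConjecture.HodgeConjecture.Cruxes.H413.K2E1BLMeromorphicGluing (exists_meromorphicOn_univ_of_balls)
open Summit.HodgeConjecture.HodgeConjecture.Cruxes.H413.K2E1BorelEisensteinRegularU (differentiableOn_eisensteinSeriesU_flatSectionU_cm_two)
open Summit.HodgeConjecture.HodgeConjecture.Cruxes.H413.K2E1BLMeromorphicFamilyByproductsU (exists_global_pole_set_of_lt)

namespace Summit.HodgeConjecture.HodgeConjecture.Cruxes.H413.K2E1ChiEisensteinMeromorphicU2

variable (L : Type) [Field L] [NumberField L] [IsCMField L]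

/-! ## §1 Whole plane from the balls, for a bounded section `φ` -/

/-- **WHOLE PLANE FROM THE BALLS FOR `E(f_z^φ)`** [BernsteinLapid2019, §2.1 + §4 p. 10].  `φ : U(J₂)(𝔸_{L⁺}) → ℂ` bounded (`‖φ‖ ≤ M`; every `χ`-section of ★ `chiSectionSpace χ K′ ω`
qualifies).  If for every `n` and every `g` some scalar function meromorphic on `ball 0 (n + 2)` agrees with `z ↦ E(f_z^φ)(g) = eisensteinSeriesU (flatSectionU φ z) g` on
`ball 0 (n + 2) ∩ {1 < Re z}` (row 12b's per-ball output), then there is `Ec : ℂ → (U(J₂)(𝔸_{L⁺}) → ℂ)`, MEROMORPHIC ON ALL OF `ℂ` in `z` for every `g`, with `Ec z = E(f_z^φ)` for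
`1 < Re z` (★ G-a gluing through normal form; holomorphy of `z ↦ E(f_z^φ)(g)` on the Godement range ★ for bounded `φ`).  The print `fun _ => φ₀ ↦ φ` of ★
`sphericalEisenstein_meromorphic_of_balls`. [cite: BernsteinLapid2019, §2.1 and §4 p. 10] [cite: MoeglinWaldspurger1995, II.1.5] -/
theorem chiEisenstein_meromorphic_of_balls {φ : (quasiSplit (↥(maximalRealSubfield L)) L (IsCMField.complexConj L) 2).Adelic → ℂ} {M : ℝ} (hφM : ∀ x, ‖φ x‖ ≤ M)
    (hball : ∀ (n : ℕ) (g : (quasiSplit (↥(maximalRealSubfield L)) L (IsCMField.complexConj L) 2).Adelic), ∃ Ec : ℂ → ℂ,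
      MeromorphicOn Ec (Metric.ball (0 : ℂ) (n + 2)) ∧ ∀ z ∈ Metric.ball (0 : ℂ) (n + 2), 1 < z.re → Ec z = eisensteinSeriesU (flatSectionU φ z) g) :
    ∃ Ec : ℂ → (quasiSplit (↥(maximalRealSubfield L)) L (IsCMField.complexConj L) 2).Adelic → ℂ,
      (∀ g, MeromorphicOn (fun z => Ec z g) univ) ∧ ∀ z : ℂ, 1 < z.re → Ec z = eisensteinSeriesU (flatSectionU φ z) := by
  have hglue : ∀ g : (quasiSplit (↥(maximalRealSubfield L)) L (IsCMField.complexConj L) 2).Adelic, ∃ G : ℂ → ℂ, MeromorphicOn G univ ∧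
      ∀ z : ℂ, 1 < z.re → G z = eisensteinSeriesU (flatSectionU φ z) g := by
    intro g
    choose F hF hFE using fun n : ℕ => hball n g
    obtain ⟨G, hG, hGE, -⟩ := exists_meromorphicOn_univ_of_balls (differentiableOn_eisensteinSeriesU_flatSectionU_cm_two L hφM g) hF hFE
    exact ⟨G, hG, hGE⟩
  choose G hG hGE using hglue
  exact ⟨fun z g => G g z, hG, fun z hz => funext fun g => hGE g z hz⟩

/-- Variant: pieces for all sufficiently large balls suffice (restrict a piece on `ball 0 (m + 2)`, `m ≥ n`, to `ball 0 (n + 2)`). [cite: BernsteinLapid2019, §2.1 and §4 p. 10] -/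
theorem chiEisenstein_meromorphic_of_eventually_balls {φ : (quasiSplit (↥(maximalRealSubfield L)) L (IsCMField.complexConj L) 2).Adelic → ℂ} {M : ℝ} (hφM : ∀ x, ‖φ x‖ ≤ M)
    (n₀ : ℕ)
    (hball : ∀ n : ℕ, n₀ ≤ n → ∀ g : (quasiSplit (↥(maximalRealSubfield L)) L (IsCMField.complexConj L) 2).Adelic, ∃ Ec : ℂ → ℂ,
      MeromorphicOn Ec (Metric.ball (0 : ℂ) (n + 2)) ∧ ∀ z ∈ Metric.ball (0 : ℂ) (n + 2), 1 < z.re → Ec z = eisensteinSeriesU (flatSectionU φ z) g) :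
    ∃ Ec : ℂ → (quasiSplit (↥(maximalRealSubfield L)) L (IsCMField.complexConj L) 2).Adelic → ℂ,
      (∀ g, MeromorphicOn (fun z => Ec z g) univ) ∧ ∀ z : ℂ, 1 < z.re → Ec z = eisensteinSeriesU (flatSectionU φ z) := by
  refine chiEisenstein_meromorphic_of_balls L hφM fun n g => ?_
  obtain ⟨Ec, hEc, hEcE⟩ := hball (max n n₀) (le_max_right _ _) g
  have hsub : Metric.ball (0 : ℂ) (n + 2) ⊆ Metric.ball (0 : ℂ) ((max n n₀ : ℕ) + 2) :=
    Metric.ball_subset_ball (by exact_mod_cast Nat.add_le_add_right (le_max_left n n₀) 2)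
  exact ⟨Ec, hEc.mono_set hsub, fun z hz hz1 => hEcE z (hsub hz) hz1⟩

/-! ## §2 The common pole set of the glued Eisenstein family and its coefficient pieces -/

/-- **ONE COMMON POLE SET FOR THE GLUED `χ`-EISENSTEIN FAMILY AND ITS COEFFICIENT PIECES** [BernsteinLapid2019, §2.1 + §4 p. 10] — ★ `exists_global_pole_set_of_lt` at `σ₀ = 1` and
the index `ι := G(𝔸) ⊕ J`.  Data: a bounded section `φ` (Godement holomorphy of `g ↦ E(f_z^φ)(g)` ★); `n₀`; scalar coefficient functions `q : J → ℂ → ℂ` holomorphic on `{1 < Re}`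
(`J` arbitrary — the matrix entries of `M(z, χ)`, the Hecke data …, or empty); per-ball co-discrete holomorphy sets `U n` (`n ≥ n₀`); per-ball pieces `F g n` of the Eisenstein family and
`Fq j n` of the coefficients, meromorphic on `ball 0 (n + 2)`, agreeing with their Godement-range functions on `{1 < Re}`, of NON-NEGATIVE ORDER on `U n`.  THEN there are the glued
`Ec : ℂ → (G(𝔸) → ℂ)`, `qc : J → ℂ → ℂ` and ONE closed co-discrete `P ⊆ {Re ≤ 1}` with: `Ec(·)(g)`, `qc j` NORMAL-FORM MEROMORPHIC on `ℂ` and ANALYTIC OFF `P` ((E1)); `Ec z = E(f_z^φ)`,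
`qc j z = q j z` for `1 < Re z`; NF-germ agreement with the ball pieces; and off `P`, unless `1 < Re z`, `z ∈ U (max n₀ ⌈‖z‖⌉₊) ∩ U (max n₀ (⌈‖z‖⌉₊ + 1))`.
[cite: BernsteinLapid2019, §2.1 and §4 p. 10] [cite: Iwaniec2002, §6.2] -/
theorem chiEisenstein_meromorphic_globalPoleSet_of_balls {φ : (quasiSplit (↥(maximalRealSubfield L)) L (IsCMField.complexConj L) 2).Adelic → ℂ} {M : ℝ} (hφM : ∀ x, ‖φ x‖ ≤ M)
    (n₀ : ℕ) {J : Type*} {q : J → ℂ → ℂ} (hq : ∀ j, DifferentiableOn ℂ (q j) {z : ℂ | 1 < z.re})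
    {U : ℕ → Set ℂ} (hU : ∀ n : ℕ, n₀ ≤ n → ∀ z₀ ∈ Metric.ball (0 : ℂ) (n + 2), ∀ᶠ s in 𝓝[≠] z₀, s ∈ U n)
    {F : (quasiSplit (↥(maximalRealSubfield L)) L (IsCMField.complexConj L) 2).Adelic → ℕ → ℂ → ℂ}
    (hF : ∀ g (n : ℕ), n₀ ≤ n → MeromorphicOn (F g n) (Metric.ball (0 : ℂ) (n + 2)))
    (hFE : ∀ g (n : ℕ), n₀ ≤ n → ∀ z ∈ Metric.ball (0 : ℂ) (n + 2), 1 < z.re → F g n z = eisensteinSeriesU (flatSectionU φ z) g)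
    (hFord : ∀ g (n : ℕ), n₀ ≤ n → ∀ z ∈ Metric.ball (0 : ℂ) (n + 2), z ∈ U n → 0 ≤ meromorphicOrderAt (F g n) z)
    {Fq : J → ℕ → ℂ → ℂ}
    (hFq : ∀ j (n : ℕ), n₀ ≤ n → MeromorphicOn (Fq j n) (Metric.ball (0 : ℂ) (n + 2)))
    (hFqq : ∀ j (n : ℕ), n₀ ≤ n → ∀ z ∈ Metric.ball (0 : ℂ) (n + 2), 1 < z.re → Fq j n z = q j z)
    (hFqord : ∀ j (n : ℕ), n₀ ≤ n → ∀ z ∈ Metric.ball (0 : ℂ) (n + 2), z ∈ U n → 0 ≤ meromorphicOrderAt (Fq j n) z) :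
    ∃ (Ec : ℂ → (quasiSplit (↥(maximalRealSubfield L)) L (IsCMField.complexConj L) 2).Adelic → ℂ) (qc : J → ℂ → ℂ) (P : Set ℂ),
      (∀ g, MeromorphicNFOn (fun z => Ec z g) univ) ∧ (∀ j, MeromorphicNFOn (qc j) univ) ∧
      (∀ z : ℂ, 1 < z.re → Ec z = eisensteinSeriesU (flatSectionU φ z)) ∧ (∀ j (z : ℂ), 1 < z.re → qc j z = q j z) ∧
      (∀ g (n : ℕ), n₀ ≤ n → ∀ z ∈ Metric.ball (0 : ℂ) (n + 2), (fun z => Ec z g) =ᶠ[𝓝[≠] z] F g n) ∧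
      (∀ j (n : ℕ), n₀ ≤ n → ∀ z ∈ Metric.ball (0 : ℂ) (n + 2), qc j =ᶠ[𝓝[≠] z] Fq j n) ∧
      IsClosed P ∧ (∀ z₀ : ℂ, ∀ᶠ s in 𝓝[≠] z₀, s ∉ P) ∧ (∀ z ∈ P, z.re ≤ 1) ∧
      (∀ z : ℂ, z ∉ P → 1 < z.re ∨ (z ∈ U (max n₀ ⌈‖z‖⌉₊) ∧ z ∈ U (max n₀ (⌈‖z‖⌉₊ + 1)))) ∧
      (∀ g (z : ℂ), z ∉ P → AnalyticAt ℂ (fun z => Ec z g) z) ∧ (∀ j (z : ℂ), z ∉ P → AnalyticAt ℂ (qc j) z) ∧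
      (∀ g, DifferentiableOn ℂ (fun z => Ec z g) Pᶜ) ∧ ∀ j, DifferentiableOn ℂ (qc j) Pᶜ := by
  -- the index `ι := G(𝔸) ⊕ J`: Eisenstein values at `g` and coefficient pieces, all scalar
  obtain ⟨gι, hgι⟩ : ∃ gι : ((quasiSplit (↥(maximalRealSubfield L)) L (IsCMField.complexConj L) 2).Adelic ⊕ J) → ℂ → ℂ,
      gι = fun a => Sum.elim (fun g z => eisensteinSeriesU (flatSectionU φ z) g) q a := ⟨_, rfl⟩
  obtain ⟨Fι, hFι⟩ : ∃ Fι : ((quasiSplit (↥(maximalRealSubfield L)) L (IsCMField.complexConj L) 2).Adelic ⊕ J) → ℕ → ℂ → ℂ,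
      Fι = fun a => Sum.elim F Fq a := ⟨_, rfl⟩
  have hgιd : ∀ a, DifferentiableOn ℂ (gι a) {z : ℂ | (1 : ℝ) < z.re} := by
    rintro (g | j)
    · rw [hgι]; exact differentiableOn_eisensteinSeriesU_flatSectionU_cm_two L hφM g
    · rw [hgι]; exact hq j
  have hFιm : ∀ a (n : ℕ), n₀ ≤ n → MeromorphicOn (Fι a n) (Metric.ball (0 : ℂ) (n + 2)) := by
    rintro (g | j) n hn
    · rw [hFι]; exact hF g n hn
    · rw [hFι]; exact hFq j n hn
  have hFιg : ∀ a (n : ℕ), n₀ ≤ n → ∀ z ∈ Metric.ball (0 : ℂ) (n + 2), (1 : ℝ) < z.re → Fι a n z = gι a z := by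
    rintro (g | j) n hn z hz hz1
    · rw [hFι, hgι]; exact hFE g n hn z hz hz1
    · rw [hFι, hgι]; exact hFqq j n hn z hz hz1
  have hFιo : ∀ a (n : ℕ), n₀ ≤ n → ∀ z ∈ Metric.ball (0 : ℂ) (n + 2), z ∈ U n → 0 ≤ meromorphicOrderAt (Fι a n) z := by
    rintro (g | j) n hn z hz hzU
    · rw [hFι]; exact hFord g n hn z hz hzU
    · rw [hFι]; exact hFqord j n hn z hz hzU
  obtain ⟨G, P, hG, hGg, hGF, hPc, hPd, hP1, hPU, hGan, hGd⟩ :=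
    exists_global_pole_set_of_lt (1 : ℝ) zero_le_one n₀ (by exact_mod_cast Nat.le_add_left 1 n₀) hgιd hU hFιm hFιg hFιo
  refine ⟨fun z g => G (Sum.inl g) z, fun j => G (Sum.inr j), P, fun g => hG (Sum.inl g), fun j => hG (Sum.inr j), fun z hz => funext fun g => ?_, fun j z hz => ?_,
    fun g n hn z hz => ?_, fun j n hn z hz => ?_, hPc, hPd, hP1, hPU, fun g z hz => hGan (Sum.inl g) z hz, fun j z hz => hGan (Sum.inr j) z hz,
    fun g => hGd (Sum.inl g), fun j => hGd (Sum.inr j)⟩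
  · have h := hGg (Sum.inl g) z hz
    rw [hgι] at h
    exact h
  · have h := hGg (Sum.inr j) z hz
    rw [hgι] at h
    exact h
  · have h := hGF (Sum.inl g) n hn z hz
    rw [hFι] at h
    exact h
  · have h := hGF (Sum.inr j) n hn z hz
    rw [hFι] at h
    exact h

end Summit.HodgeConjecture.HodgeConjecture.Cruxes.H413.K2E1ChiEisensteinMeromorphicU2

end
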